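import Summits.HubbardSuperconductivity.HubbardSuperconductivity.Theorems.BalabanIRBirComplexStableXYRCovarianceFRDGradient
import Summits.HubbardSuperconductivity.HubbardSuperconductivity.Theorems.BalabanIRBirComplexStableXYRCovarianceReflection
import Summits.HubbardSuperconductivity.HubbardSuperconductivity.Theorems.BalabanIRBirComplexStableXYRCoulombFieldLaplacian
import Literature.Analysis.Matrix.TorusGreenGradientDecayTemporal
import HarnessLib

/-!
# Crux `BirComplexStableXYR` (stmt-HubbardSuperconductivity-14845), line `fat-gaussian-defect-calculus`, chapter 2 input
# (lead c7, item G2c): VOLUME-UNIFORM DIPOLE/QUADRUPOLE DECAY of the engine's reference Green's function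

Support file (prover seat 1, route BalabanIR).  The Green's function of the rescaled site Hessian
`A_c = (4/Λ_c)•H_c` (`Λ_c = 2·normA(c)·r³`; `H_c` the inline Hessian matrix of the landed covariance stubs, so that
`pinv A_c = (Λ_c/4)·H_c⁺` with `H_c⁺` the pseudo-inverse = covariance of the thin Gaussian on gradient observables) on the
space–time torus `Λ L M = (ℤ/L)² × ℤ/M`, `L ≤ M`, obeys UNIFORMLY IN THE VOLUME, for every neutral (N), coercive (C) table of
range `r ≥ 2` (instantiation of `Literature/Analysis/Matrix/TorusGreenGradientDecay{,Temporal}.lean` at `m = 2`,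
`R = 3(r − 1)`, `c₀' = 4c₀/Λ_c`, with the landed instance facts `cfrd_addChar_ext`, `cfrd_order`, `cfrd_card`,
`cfrd_scaled_facts`, `cfrd_hasFiniteRange`, `cfrd_reflectionInvariant`):

* `birGreen_decay_spatial` (registered stub) — lists `l` of `k ∈ {1,2}` unit steps with a spatial one:
  `|∇_l pinv A_c (x,y)| ≤ 2K₃/max(1,(d(x,y) − k)/(12(r−1)))^{k+1} + 2K₁/L^{k+1}`;
* `birGreen_decay_temporal` (registered stub) — two temporal steps: the same with `2(K₂ + 2K₁)/L³`;
* `birGreen_decay_temporalOne` (registered stub) — under (R) (time-reflection symmetry of `H_c`), the single temporal step: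
  `|∇_{e₂} pinv A_c (x,y)| ≤ 2K₃/max(1,(d(x,y) − 1)/(12(r−1)))² + 96(r−1)(K₂ + 2K₁)/L²`,

`d` the torus `ℓ¹` distance; `K₃, K₁, K₂` the explicit constants of the Literature files at `m = 2`, `c₀' = 4c₀/Λ_c`.  This is
the Biot–Savart / dipole law `|∇G| ≲ d^{−2}`, `|∇²G| ≲ d^{−3}` up to the spatial period (saturating at `L^{−(k+1)}` beyond it),
the kernel input for the decay of the Coulomb strain `σ_a` away from the vortices in lead c7's representation.

Helpers: `gd_sum_aform` / `gd_rowsum` (`H_c` annihilates constants under (N)), `gd_timeReflection_e2/_spatial`, `gd_decompose`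
(unit steps / time reflection: `cfl_step_le_one`, `cfl_timeReflection_apply` of `…CoulombFieldLaplacian.lean`).  No definitions; sorry-free. [folklore]
-/

noncomputable section

namespace Summit.HubbardSuperconductivity.HubbardSuperconductivity.Theorems

set_option linter.dupNamespace false -- summit = problem name (single-conjunct summit), D-0017

open scoped BigOperators Matrix ComplexConjugate
open Complex Summit.HubbardSuperconductivity.BirComplexStableXYNegative
open Literature.Probability.LatticeModels Literature.Analysis.Matrix Literature.Analysis.Fourier

section GreenDecay

variable {r : ℕ} {L M : ℕ} [NeZero L] [NeZero M]

-- The window linear form `a_{(s,n)}(j) = Σ_w n_w [sh s w = j]` (local abbreviation).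
set_option quotPrecheck false in
local notation "aform[" L' "," M' "](" s "," n "," j ")" =>
  ∑ w, (((n w : ℤ) : ℝ) * (if sh L' M' s w = j then (1 : ℝ) else 0))

-- The inline Hessian matrix of `Q_c` (local abbreviation).
set_option quotPrecheck false in
local notation "Hm[" c' "," L' "," M' "]" => (Matrix.of fun i j : Λ L' M' =>
  (-(∑ k : Λ L' M' × ↥((c' : Table _).support),
    (c' : Table _) k.2 * ((aform[L',M'](k.1, k.2.1, i) : ℝ) : ℂ)
      * ((aform[L',M'](k.1, k.2.1, j) : ℝ) : ℂ))).re)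

-- the torus `ℓ¹` distance (local abbreviation; inline in statements)
set_option quotPrecheck false in
local notation "tdist[" L' "," M' "]" => (fun i j : Λ L' M' =>
  ((j.1 0 - i.1 0).valMinAbs.natAbs + (j.1 1 - i.1 1).valMinAbs.natAbs + (j.2 - i.2).valMinAbs.natAbs))

-- the three unit steps of the space-time torus (local abbreviation; inline in statements)
set_option quotPrecheck false in
local notation "Evec[" L' "," M' "]" =>
  (![((![1, 0] : Literature.Probability.LatticeModels.TorusSite 2 L'), (0 : ZMod M')), (![0, 1], 0), (0, 1)]
    : Fin 3 → Λ L' M')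

/-! ## `H_c` annihilates constants under (N) -/

/-- Under (N) the window linear form has zero total: `Σ_j a_{(s,n)}(j) = Σ_w n_w = 0`. [folklore] -/
theorem gd_sum_aform (s : Λ L M) {n : Freq r} (hn : ∑ w, n w = 0) : ∑ j : Λ L M, aform[L,M](s, n, j) = 0 := by
  rw [Finset.sum_comm]
  have : ∀ w : W r, ∑ j : Λ L M, ((n w : ℤ) : ℝ) * (if sh L M s w = j then (1 : ℝ) else 0) = (n w : ℝ) := by
    intro w
    rw [← Finset.mul_sum, Finset.sum_ite_eq]
    simp
  rw [Finset.sum_congr rfl fun w _ => this w]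
  exact_mod_cast hn

/-- **Zero row sums**: under (N), `Σ_j H_c(i,j) = 0` (constants are in the kernel of the site Hessian). [folklore] -/
theorem gd_rowsum (c : Table r) (hN : ∀ n ∈ c.support, ∑ w, n w = 0) (i : Λ L M) : ∑ j : Λ L M, Hm[c,L,M] i j = 0 := by
  simp only [Matrix.of_apply]
  rw [← Complex.re_sum, Finset.sum_neg_distrib, Finset.sum_comm]
  have hk : ∀ k : Λ L M × ↥c.support, ∑ j : Λ L M,
      c k.2 * ((aform[L,M](k.1, k.2.1, i) : ℝ) : ℂ) * ((aform[L,M](k.1, k.2.1, j) : ℝ) : ℂ) = 0 := by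
    intro k
    rw [← Finset.mul_sum, ← Complex.ofReal_sum, gd_sum_aform k.1 (hN k.2.1 k.2.2)]
    simp
  simp only [hk, Finset.sum_const_zero, neg_zero, Complex.zero_re]

/-- The symbol of the rescaled Hessian vanishes at the trivial character (under (N)). [folklore] -/
theorem gd_symbol_one (c : Table r) (hN : ∀ n ∈ c.support, ∑ w, n w = 0) (t : ℝ) :
    symbol (t • Hm[c,L,M]) 1 = 0 := by
  refine symbol_one_eq_zero_of_sum_eq_zero ?_
  simp only [Matrix.smul_apply, smul_eq_mul, ← Finset.mul_sum, gd_rowsum c hN, mul_zero]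

/-! ## Geometry of the space–time torus: unit steps, time reflection -/

omit [NeZero L] [NeZero M] in
/-- The time reflection reverses the temporal unit step. [folklore] -/
theorem gd_timeReflection_e2 :
    (AddEquiv.prodCongr (AddEquiv.refl (TorusSite 2 L)) (AddEquiv.neg (ZMod M))) (Evec[L,M] 2) = -(Evec[L,M] 2) := by
  rw [cfl_timeReflection_apply]
  simp

omit [NeZero L] [NeZero M] in
/-- The time reflection fixes purely spatial vectors. [folklore] -/
theorem gd_timeReflection_spatial (v : TorusSite 2 L) :
    (AddEquiv.prodCongr (AddEquiv.refl (TorusSite 2 L)) (AddEquiv.neg (ZMod M))) (v, 0) = (v, 0) := by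
  rw [cfl_timeReflection_apply]; simp

omit [NeZero L] [NeZero M] in
/-- Every separation splits as spatial part plus an integer multiple of the temporal step, with the integer bounded by the
torus distance: `y = x + (v,0) + n•e₂`, `|n| ≤ d(x,y)`. [folklore] -/
theorem gd_decompose (x y : Λ L M) :
    y = x + ((y - x).1, 0) + ((y - x).2.valMinAbs : ℤ) • Evec[L,M] 2
      ∧ ((y - x).2.valMinAbs).natAbs ≤ tdist[L,M] x y := by
  constructor
  · have h2 : (((y - x).2.valMinAbs : ℤ) • Evec[L,M] 2) = ((0 : TorusSite 2 L), (y - x).2) := by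
      simp only [Matrix.cons_val_two, Matrix.tail_cons, Matrix.head_cons, Prod.smul_mk, smul_zero, zsmul_eq_mul, mul_one,
        ZMod.coe_valMinAbs]
    rw [h2]
    ext <;> simp
  · simp only [Prod.snd_sub]
    omega

/-! ## The decay of the reference Green's function (registered stubs) -/

/-- **Registered stub `birGreen_decay_spatial` (prover seat 1, stmt-HubbardSuperconductivity-14845; lead c7 chapter-2 input G2c):
dipole / quadrupole decay of the reference Green's function for differences with a spatial step**, uniformly in
`L ≤ M`: for every (N),(C) table at range `r ≥ 2`, every list `l` of `k ∈ {1,2}` unit steps `±e_i` containing `±e₀` or `±e₁`,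
`|∇_l pinv((4/Λ_c)H_c)(x,y)| ≤ 2K₃/max(1,(d(x,y) − k)/(12(r−1)))^{k+1} + 2K₁/L^{k+1}`. [folklore] -/
theorem birGreen_decay_spatial : ∀ (r : ℕ) (c : Table r) (c₀ : ℝ), 2 ≤ r → 0 < c₀ → (∀ n ∈ c.support, ∑ w, n w = 0) → c.sum (fun _ a => a) = 0 → (∀ φ : W r → ℝ, c₀ * ∑ w, ∑ w', (1 - Real.cos (φ w - φ w')) ≤ (genF c φ).re) → ∀ (L M : ℕ) [NeZero L] [NeZero M], L ≤ M → ∀ (l : List (Λ L M)), (∀ g ∈ l, ∃ i : Fin 3, g = (![((![1, 0] : Literature.Probability.LatticeModels.TorusSite 2 L), (0 : ZMod M)), (![0, 1], 0), (0, 1)] : Fin 3 → Λ L M) i ∨ g = -((![((![1, 0] : Literature.Probability.LatticeModels.TorusSite 2 L), (0 : ZMod M)), (![0, 1], 0), (0, 1)] : Fin 3 → Λ L M) i)) → (∃ g ∈ l, g = (![((![1, 0] : Literature.Probability.LatticeModels.TorusSite 2 L), (0 : ZMod M)), (![0, 1], 0), (0, 1)] : Fin 3 → Λ L M) 0 ∨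 g = -((![((![1, 0] : Literature.Probability.LatticeModels.TorusSite 2 L), (0 : ZMod M)), (![0, 1], 0), (0, 1)] : Fin 3 → Λ L M) 0) ∨ g = (![((![1, 0] : Literature.Probability.LatticeModels.TorusSite 2 L), (0 : ZMod M)), (![0, 1], 0), (0, 1)] : Fin 3 → Λ L M) 1 ∨ g = -((![((![1, 0] : Literature.Probability.LatticeModels.TorusSite 2 L), (0 : ZMod M)), (![0, 1], 0), (0, 1)] : Fin 3 → Λ L M) 1)) → l.length ≤ 2 → ∀ x y : Λ L M, |Literature.Analysis.Fourier.rowDiffs l (Literature.Analysis.Fourier.pinv ((4 / (2 * normA c * (r : ℝ) ^ 3)) • (Matrix.of fun i j : Λ L M => (-(∑ k : Λ L M × ↥c.support, c k.2 * ((∑ w, ((k.2 : Freq r) w : ℝ) * (if sh L M k.1 w = i then (1 : ℝ) else 0) : ℝ) : ℂ) * ((∑ w, ((k.2 : Freq r) w : ℝ) * (if sh L M k.1 w = j then (1 : ℝ) else 0) : ℝ) : ℂ))).re))) x y| ≤ 2 * (27 * 2 * (2 * Real.pi) ^ l.length / 4 * (1 + 2 ^ (l.length + 4) * Real.pi ^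 (2 * 2 + 2) / (16 * (4 * c₀ / (2 * normA c * (r : ℝ) ^ 3))) ^ (2 + 1))) * (1 / max 1 (((((y.1 0 - x.1 0).valMinAbs.natAbs + (y.1 1 - x.1 1).valMinAbs.natAbs + (y.2 - x.2).valMinAbs.natAbs : ℕ) : ℝ) - l.length) / (2 * (2 : ℕ) * (3 * (r - 1) : ℕ)))) ^ (l.length + 1) + 2 * (27 * 2 * (2 * Real.pi) ^ l.length * Real.pi ^ (2 * 2 + 2) * 2 ^ (l.length + 4) / (4 * (16 * (4 * c₀ / (2 * normA c * (r : ℝ) ^ 3))) ^ (2 + 1))) * (1 / (L : ℝ)) ^ (l.length + 1) := by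
  intro r c c₀ hr hc₀ hNN hN hC L M _ _ hLM l hl hspat hk2 x y
  obtain ⟨hAherm, hAti, hApsd, hA4, hcoer⟩ := cfrd_scaled_facts (L := L) (M := M) hr c hc₀ hN hC
  have hc₀' : 0 < 4 * c₀ / (2 * normA c * (r : ℝ) ^ 3) := div_pos (by positivity) (cfrd_scale_pos hr c hc₀ hC)
  have hkm : l.length + 2 ≤ 2 * 2 := by omega
  have h := abs_rowDiffs_pinv_le_spatial (m := 2) (Evec[L,M]) (![L, L, M])
    (fun i => by fin_cases i <;> simp [NeZero.ne L, NeZero.ne M]) (fun i => cfrd_order i)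
    (fun ψ φ h => cfrd_addChar_ext ψ φ h) cfrd_card rfl (by simpa using hLM)
    hAti hAherm hApsd hA4 hc₀' hcoer (gd_symbol_one c hNN _)
    (fun i j k => cfrd_tdist_triangle i j k) (fun i => cfrd_tdist_self i) (fun i z => cfl_step_le_one i z)
    ((cfrd_hasFiniteRange c).smul _) l hl hspat hkm x y
  simpa using h

/-- **Registered stub `birGreen_decay_temporal` (prover seat 1, stmt-HubbardSuperconductivity-14845): quadrupole decay of the
reference Green's function for two temporal differences**, uniformly in `L ≤ M`:
`|∇_{±e₂}∇_{±e₂} pinv((4/Λ_c)H_c)(x,y)| ≤ 2K₃/max(1,(d(x,y) − 2)/(12(r−1)))³ + 2(K₂ + 2K₁)/L³`. [folklore] -/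
theorem birGreen_decay_temporal : ∀ (r : ℕ) (c : Table r) (c₀ : ℝ), 2 ≤ r → 0 < c₀ → (∀ n ∈ c.support, ∑ w, n w = 0) → c.sum (fun _ a => a) = 0 → (∀ φ : W r → ℝ, c₀ * ∑ w, ∑ w', (1 - Real.cos (φ w - φ w')) ≤ (genF c φ).re) → ∀ (L M : ℕ) [NeZero L] [NeZero M], L ≤ M → ∀ (l : List (Λ L M)), (∀ g ∈ l, g = (![((![1, 0] : Literature.Probability.LatticeModels.TorusSite 2 L), (0 : ZMod M)), (![0, 1], 0), (0, 1)] : Fin 3 → Λ L M) 2 ∨ g = -((![((![1, 0] : Literature.Probability.LatticeModels.TorusSite 2 L), (0 : ZMod M)), (![0, 1], 0), (0, 1)] : Fin 3 → Λ L M) 2)) → l.length = 2 → ∀ x y : Λ L M, |Literature.Analysis.Fourier.rowDiffs l (Literature.Analysis.Fourier.pinv ((4 / (2 * normA c * (r : ℝ) ^ 3)) • (Matrix.of fun i j : Λ L M => (-(∑ k : Λ L M × ↥c.support, c k.2 * ((∑ w, ((k.2 : Freq r) w : ℝ) * (if sh L M k.1 w = i then (1 : ℝ) else 0) : ℝ)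 : ℂ) * ((∑ w, ((k.2 : Freq r) w : ℝ) * (if sh L M k.1 w = j then (1 : ℝ) else 0) : ℝ) : ℂ))).re))) x y| ≤ 2 * (27 * 2 * (2 * Real.pi) ^ 2 / 4 * (1 + 2 ^ (2 + 4) * Real.pi ^ (2 * 2 + 2) / (16 * (4 * c₀ / (2 * normA c * (r : ℝ) ^ 3))) ^ (2 + 1))) * (1 / max 1 (((((y.1 0 - x.1 0).valMinAbs.natAbs + (y.1 1 - x.1 1).valMinAbs.natAbs + (y.2 - x.2).valMinAbs.natAbs : ℕ) : ℝ) - 2) / (2 * (2 : ℕ) * (3 * (r - 1) : ℕ)))) ^ (2 + 1) + 2 * (27 * 2 * (2 * Real.pi) ^ 2 / 4 * (1 + 5 * 2 ^ (2 + 2) * Real.pi ^ (2 * 2 + 2) / (16 * (4 * c₀ / (2 * normA c * (r : ℝ) ^ 3))) ^ (2 + 1)) + 2 * (27 * 2 * (2 * Real.pi) ^ 2 * Real.pi ^ (2 * 2 + 2) * 2 ^ (2 + 4) / (4 * (16 * (4 * c₀ / (2 * normA c * (r : ℝ) ^ 3))) ^ (2 + 1)))) * (1 / (L : ℝ)) ^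 (2 - 1) * (1 / (L : ℝ) ^ 2) := by
  intro r c c₀ hr hc₀ hNN hN hC L M _ _ hLM l htemp hk x y
  obtain ⟨hAherm, hAti, hApsd, hA4, hcoer⟩ := cfrd_scaled_facts (L := L) (M := M) hr c hc₀ hN hC
  have hc₀' : 0 < 4 * c₀ / (2 * normA c * (r : ℝ) ^ 3) := div_pos (by positivity) (cfrd_scale_pos hr c hc₀ hC)
  have h := abs_rowDiffs_pinv_le_temporal (m := 2) (Evec[L,M]) (![L, L, M])
    (fun i => by fin_cases i <;> simp [NeZero.ne L, NeZero.ne M]) (fun i => cfrd_order i)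
    (fun ψ φ h => cfrd_addChar_ext ψ φ h) cfrd_card rfl (by simpa using hLM)
    hAti hAherm hApsd hA4 hc₀' hcoer (gd_symbol_one c hNN _)
    (fun i j k => cfrd_tdist_triangle i j k) (fun i => cfrd_tdist_self i) (fun i z => cfl_step_le_one i z)
    ((cfrd_hasFiniteRange c).smul _) l htemp (by omega) (by omega) x y
  rw [hk] at h
  simpa using h

/-- **Registered stub `birGreen_decay_temporalOne` (prover seat 1, stmt-HubbardSuperconductivity-14845): dipole decay of the single
temporal gradient of the reference Green's function**, uniformly in `L ≤ M`, for (N),(C),(R) tables ((R) = time-reflection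
symmetry of `H_c`, the input of the evenness device `ConvolutionOperatorReflection`):
`|∇_{e₂} pinv((4/Λ_c)H_c)(x,y)| ≤ 2K₃/max(1,(d(x,y) − 1)/(12(r−1)))² + 96(r−1)(K₂ + 2K₁)/L²`. [folklore] -/
theorem birGreen_decay_temporalOne : ∀ (r : ℕ) (c : Table r) (c₀ : ℝ), 2 ≤ r → 0 < c₀ → (∀ n ∈ c.support, ∑ w, n w = 0) → c.sum (fun _ a => a) = 0 → (∀ φ : W r → ℝ, c₀ * ∑ w, ∑ w', (1 - Real.cos (φ w - φ w')) ≤ (genF c φ).re) → (∀ n : Freq r, c (fun w => n (w.1, w.2.1, Fin.rev w.2.2)) = (starRingEnd ℂ) (c (-n))) → ∀ (L M : ℕ) [NeZero L] [NeZero M], L ≤ M → ∀ x y : Λ L M, |Literature.Analysis.Fourier.rowDiff ((0 : Literature.Probability.LatticeModels.TorusSite 2 L), (1 : ZMod M)) (Literature.Analysis.Fourier.pinv ((4 / (2 * normA c * (r : ℝ) ^ 3)) • (Matrix.of fun i j : Λ L M => (-(∑ k : Λ L M × ↥c.support, c k.2 * ((∑ w, ((k.2 : Freq r) w : ℝ)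 * (if sh L M k.1 w = i then (1 : ℝ) else 0) : ℝ) : ℂ) * ((∑ w, ((k.2 : Freq r) w : ℝ) * (if sh L M k.1 w = j then (1 : ℝ) else 0) : ℝ) : ℂ))).re))) x y| ≤ 2 * (27 * 2 * (2 * Real.pi) / 4 * (1 + 2 ^ 5 * Real.pi ^ (2 * 2 + 2) / (16 * (4 * c₀ / (2 * normA c * (r : ℝ) ^ 3))) ^ (2 + 1))) * (1 / max 1 (((((y.1 0 - x.1 0).valMinAbs.natAbs + (y.1 1 - x.1 1).valMinAbs.natAbs + (y.2 - x.2).valMinAbs.natAbs : ℕ) : ℝ) - 1) / (2 * (2 : ℕ) * (3 * (r - 1) : ℕ)))) ^ 2 + 16 * (2 : ℕ) * (3 * (r - 1) : ℕ) * ((27 * 2 * (2 * Real.pi) ^ 2 / 4 * (1 + 5 * 2 ^ 4 * Real.pi ^ (2 * 2 + 2) / (16 * (4 * c₀ / (2 * normA c * (r : ℝ) ^ 3))) ^ (2 + 1))) + 2 * (27 * 2 * (2 * Real.pi) ^ 2 * Real.pi ^ (2 * 2 + 2) * 2 ^ 6 / (4 * (16 * (4 * c₀ / (2 * normA c * (r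 : ℝ) ^ 3))) ^ (2 + 1)))) / (L : ℝ) ^ 2 := by
  intro r c c₀ hr hc₀ hNN hN hC hRR L M _ _ hLM x y
  obtain ⟨hAherm, hAti, hApsd, hA4, hcoer⟩ := cfrd_scaled_facts (L := L) (M := M) hr c hc₀ hN hC
  have hc₀' : 0 < 4 * c₀ / (2 * normA c * (r : ℝ) ^ 3) := div_pos (by positivity) (cfrd_scale_pos hr c hc₀ hC)
  set τ := AddEquiv.prodCongr (AddEquiv.refl (TorusSite 2 L)) (AddEquiv.neg (ZMod M)) with hτ
  have hτA : ∀ a b : Λ L M, ((4 / (2 * normA c * (r : ℝ) ^ 3)) • Hm[c,L,M]) (τ a) (τ b)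
      = ((4 / (2 * normA c * (r : ℝ) ^ 3)) • Hm[c,L,M]) a b := by
    intro a b
    rw [Matrix.smul_apply, Matrix.smul_apply, cfl_timeReflection_apply, cfl_timeReflection_apply,
      cfrd_reflectionInvariant c hRR a b]
  obtain ⟨hdec, hnD⟩ := gd_decompose x y
  have hR1 : 1 ≤ 3 * (r - 1) := by omega
  have h := abs_rowDiff_pinv_le_temporal_one (m := 2) (Evec[L,M]) (![L, L, M])
    (fun i => by fin_cases i <;> simp [NeZero.ne L, NeZero.ne M]) (fun i => cfrd_order i)
    (fun ψ φ h => cfrd_addChar_ext ψ φ h) cfrd_card rfl (by simpa using hLM)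
    hAti hAherm hApsd hA4 hc₀' hcoer (gd_symbol_one c hNN _)
    (fun i j k => cfrd_tdist_triangle i j k) (fun i => cfrd_tdist_self i) (fun i z => cfl_step_le_one i z)
    ((cfrd_hasFiniteRange c).smul _) hR1 τ hτA gd_timeReflection_e2 le_rfl x ((y - x).1, 0)
    (gd_timeReflection_spatial _) ((y - x).2.valMinAbs) (by rw [← hdec]; exact hnD)
  rw [← hdec] at h
  have hE2 : (Evec[L,M] 2) = ((0 : TorusSite 2 L), (1 : ZMod M)) := by simp
  rw [hE2] at h
  simpa using h

end GreenDecay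

end Summit.HubbardSuperconductivity.HubbardSuperconductivity.Theorems

end
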